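import Summits.ABC.StewartYu.PadicG3TwoNegBound
import Summits.ABC.StewartYu.SatFrameKit
import HarnessLib

/-!
# Cell abc-stewartyu, WP-L.P(2) (crux r4 `PadicCoreTwoRat`, stmt-ABC-20504), record-side helper: the NEGATED BOUND of the crux datum
# transported to the 𝔑-threaded set-up `ofData d ϑ (b ᵥ* C) …` (`Θ = (∏ αⱼ^{bⱼ})²`)

`Summits/ABC/StewartYu/PadicG3TwoNegBoundSat.lean` — cell `abc-stewartyu` (HOME `run/shared/lean/pub/abc-stewartyu/`), route
`YuMatveevShapeRat`, seat p3 (g9; HOME/p3/memo-12 §2).  Theorems only.  For the record's supply `RecordSupplyTwoSat`: the set-up built on a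
presentation `α² = ϑ^C` with coefficients `b̃ = b ᵥ* C` has `∏ₖ ϑₖ^{b̃ₖ} = (∏ⱼ αⱼ^{bⱼ})²`, and `ord₂(x − 1) ≤ ord₂(x² − 1)` for the `2`-adic
unit `x = ∏ αⱼ^{bⱼ} ≡ 1 (mod 8)`; hence the crux's negated bound `¬ ord₂(∏ αⱼ^{bⱼ} − 1) ≤ T` gives `¬ ord₂(Θ(ofData) − 1) ≤ T` and the
landed smallness `‖Λ₀(ofData)‖ ≤ |b̃_last|·2^{−U}` for every `U ≤ T` (`PadicG3TwoNegBound.norm_Λ₀_ofData_le_of_not_le`).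

* `prod_zpow_vecMul_eq_sq` — `∏ₖ ϑₖ^{(b ᵥ* C)ₖ} = (∏ⱼ αⱼ^{bⱼ})²`;
* `padicValRat_sub_one_le_sq_sub_one` — `ord₂(x − 1) ≤ ord₂(x² − 1)` for `x = ∏ αⱼ^{bⱼ}`, `αⱼ ≡ 1 (mod 8)`, `b ≠ 0`, `α` independent;
* **`not_le_padicValRat_sat`**, **`norm_Λ₀_ofData_sat_le`**.

WHAT THIS IS NOT: no record; no crux moves (A1.L not moved).

References: K. Yu, Acta Math. 211 (2013), (5.19), Lemma 5.1; Yu. V. Nesterenko, LNM 1819 (2003) §4.3; HOME/p3/memo-12 §2.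
-/

noncomputable section

open Finset
open scoped Matrix

namespace Summit.ABC.StewartYu

namespace TwoSetup

variable {d : ℕ}

/-- **`∏ₖ ϑₖ^{(b ᵥ* C)ₖ} = (∏ⱼ αⱼ^{bⱼ})²`** when `αⱼ² = ∏ₖ ϑₖ^{C j k}`. [cite: Nesterenko2003, §4.3 Cor 4.5; shape only] -/
theorem prod_zpow_vecMul_eq_sq (α ϑ : Fin (d + 1) → ℚ) (hϑ0 : ∀ k, ϑ k ≠ 0) (Cm : Matrix (Fin (d + 1)) (Fin (d + 1)) ℤ)
    (hαo : ∀ j, α j ^ 2 = ∏ k, ϑ k ^ Cm j k) (b : Fin (d + 1) → ℤ) :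
    ∏ k, ϑ k ^ (b ᵥ* Cm) k = (∏ j, α j ^ b j) ^ 2 := by
  rw [SatCoords.prod_zpow_vecMul_eq (fun j => α j ^ 2) ϑ hϑ0 Cm hαo b, ← SatFrameKit.prod_sq_zpow]

/-- **`ord₂(x − 1) ≤ ord₂(x² − 1)`** for `x = ∏ αⱼ^{bⱼ}` with `αⱼ ≡ 1 (mod 8)` independent and `b ≠ 0` (`x` is a `2`-adic unit `≠ ±1`).
[cite: Yu2013, Lemma 5.1; shape only] -/
theorem padicValRat_sub_one_le_sq_sub_one (α : Fin (d + 1) → ℚ) (hα : ∀ j, 3 ≤ padicValRat 2 (α j - 1))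
    (hind : ∀ μ : Fin (d + 1) → ℤ, ∏ j, α j ^ μ j = 1 → μ = 0) (b : Fin (d + 1) → ℤ) (hb : b ≠ 0) :
    padicValRat 2 (∏ j, α j ^ b j - 1) ≤ padicValRat 2 ((∏ j, α j ^ b j) ^ 2 - 1) := by
  haveI : Fact (Nat.Prime 2) := ⟨Nat.prime_two⟩
  have hα0 : ∀ j, α j ≠ 0 := fun j => ne_zero_of_three_le (hα j)
  have hαv : ∀ j, padicValRat 2 (α j) = 0 := fun j => GenThreeInductionTwo.padicValRat_eq_zero_of_three_le (hα j)
  have hx0 : ∏ j, α j ^ b j ≠ 0 := prod_ne_zero_iff.mpr fun j _ => zpow_ne_zero _ (hα0 j)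
  have hxv : padicValRat 2 (∏ j, α j ^ b j) = 0 := SatFrameKit.padicValRat_prod_zpow_eq_zero α hα0 hαv b
  have hne1 : ∏ j, α j ^ b j ≠ 1 := fun h => hb (hind b h)
  have hne_neg : ∏ j, α j ^ b j ≠ -1 := by
    intro hneg
    have h3 := GenThreeInductionTwo.three_le_padicValRat_prod_zpow_sub_one α hα b hne1
    rw [hneg, show ((-1 : ℚ) - 1) = -2 by norm_num, padicValRat.neg] at h3
    have h2 : padicValRat 2 (2 : ℚ) = 1 := by
      have := padicValRat.self (p := 2) one_lt_two
      simpa using this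
    rw [h2] at h3
    exact absurd h3 (by norm_num)
  have hsq : (∏ j, α j ^ b j) ^ (2 : ℤ) ≠ 1 := by
    intro h
    have h' : (∏ j, α j ^ b j) * (∏ j, α j ^ b j) = 1 := by
      rw [← sq]; exact_mod_cast h
    rcases mul_self_eq_one_iff.mp h' with h1 | h1
    · exact hne1 h1
    · exact hne_neg h1
  have hle := Literature.Barriers.ABC.padicValRat_sub_one_le_zpow_sub_one hx0 hxv (n := 2) two_ne_zero hsq
  rw [← zpow_ofNat]
  exact_mod_cast hle

/-- **The crux's negated bound transported to the saturated presentation**: `¬ ord₂(∏ⱼ αⱼ^{bⱼ} − 1) ≤ T` gives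
`¬ ord₂(∏ₖ ϑₖ^{(b ᵥ* C)ₖ} − 1) ≤ T`. [cite: Yu2013, (5.19); shape only] -/
theorem not_le_padicValRat_sat (α ϑ : Fin (d + 1) → ℚ) (hα : ∀ j, 3 ≤ padicValRat 2 (α j - 1))
    (hind : ∀ μ : Fin (d + 1) → ℤ, ∏ j, α j ^ μ j = 1 → μ = 0) (b : Fin (d + 1) → ℤ) (hb : b ≠ 0)
    (hϑ0 : ∀ k, ϑ k ≠ 0) (Cm : Matrix (Fin (d + 1)) (Fin (d + 1)) ℤ) (hαo : ∀ j, α j ^ 2 = ∏ k, ϑ k ^ Cm j k) {T : ℝ}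
    (hneg : ¬ (padicValRat 2 (∏ j, α j ^ b j - 1) : ℝ) ≤ T) :
    ¬ (padicValRat 2 (∏ k, ϑ k ^ (b ᵥ* Cm) k - 1) : ℝ) ≤ T := by
  rw [prod_zpow_vecMul_eq_sq α ϑ hϑ0 Cm hαo b]
  intro h
  apply hneg
  have := padicValRat_sub_one_le_sq_sub_one α hα hind b hb
  exact le_trans (by exact_mod_cast this) h

/-- **THE SMALLNESS INPUT OF THE 𝔑-THREADED FRAME from the crux's negated bound**: for the pivot-last set-up
`ofData d ϑ (b ᵥ* C) …` with `αⱼ² = ∏ ϑₖ^{C j k}`, `ϑ` independent: if `¬ ord₂(∏ αⱼ^{bⱼ} − 1) ≤ T` then for every natural `U ≤ T`,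
`‖Λ₀(ofData)‖ ≤ |(b ᵥ* C)_last|·2^{−U}`. [cite: Yu2013, (5.19) and Lemma 5.1; shape only] -/
theorem norm_Λ₀_ofData_sat_le (α ϑ : Fin (d + 1) → ℚ) (hα : ∀ j, 3 ≤ padicValRat 2 (α j - 1))
    (hind : ∀ μ : Fin (d + 1) → ℤ, ∏ j, α j ^ μ j = 1 → μ = 0) (b : Fin (d + 1) → ℤ) (hb : b ≠ 0)
    (hϑ : ∀ k, 3 ≤ padicValRat 2 (ϑ k - 1)) (hϑind : ∀ μ : Fin (d + 1) → ℤ, ∏ k, ϑ k ^ μ k = 1 → μ = 0)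
    (Cm : Matrix (Fin (d + 1)) (Fin (d + 1)) ℤ) (hαo : ∀ j, α j ^ 2 = ∏ k, ϑ k ^ Cm j k)
    (hlast : (b ᵥ* Cm) (Fin.last d) ≠ 0)
    (hmin : ∀ k, (b ᵥ* Cm) k ≠ 0 → padicValInt 2 ((b ᵥ* Cm) (Fin.last d)) ≤ padicValInt 2 ((b ᵥ* Cm) k))
    {T : ℝ} (hneg : ¬ (padicValRat 2 (∏ j, α j ^ b j - 1) : ℝ) ≤ T) {U : ℕ} (hUT : (U : ℝ) ≤ T) :
    ‖(ofData d ϑ (b ᵥ* Cm) hϑ hlast hmin).Λ₀‖ ≤ |((b ᵥ* Cm) (Fin.last d) : ℝ)| * ((2 : ℕ) : ℝ) ^ (-(U : ℤ)) := by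
  have hϑ0 : ∀ k, ϑ k ≠ 0 := fun k => ne_zero_of_three_le (hϑ k)
  have hbt : b ᵥ* Cm ≠ 0 := fun h0 => hlast (by rw [h0]; rfl)
  exact norm_Λ₀_ofData_le_of_not_le ϑ (b ᵥ* Cm) hϑ hlast hmin hϑind hbt
    (not_le_padicValRat_sat α ϑ hα hind b hb hϑ0 Cm hαo hneg) hUT

end TwoSetup

end Summit.ABC.StewartYu

end
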